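import Literature.NumberTheory.Weil1965.AdelicFibreMeasuresCutoff
import HarnessLib

/-!
# From fibrewise proportional measures to proportional functionals on `𝒮(𝔸_F^ι)` (the Siegel–Weil closing step)

Topic `NumberTheory/Weil1965`; namespace `Literature.NumberTheory.Weil1965` (sequel of `AdelicFibreMeasures`,
`AdelicFibreMeasuresCutoff`). KERNEL MATHEMATICS ONLY: proved theorems, no definition, no named fact, no `sorry`.

Weil's proof of the Siegel formula [Weil1965, Chap. IV n° 43–51] compares the Eisenstein measure
`E_X = Σ_b μ_b` with the theta measure `I_X = Σ_b μ̂_b` FIBRE BY FIBRE (`μ_b = κ μ̂_b`: uniqueness of invariant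
measures on the orbits `h = b`, n° 46 and Lemme 22, plus the identification of the constant, n° 50–51) and concludes
`E_X = κ I_X` as tempered measures, i.e. as functionals on `𝒮(X)`. This file is that last, purely formal step in the
tree's currency (positive functionals `S₁, S₂` on `𝒮_ℝ(X)`, their Radon measures `schwartzBruhatMeasure` and fibre
measures `fibreMeasure … h b` along `h : X → 𝔸_F`):

* `integral_schwartzBruhatMeasure_eq_smul_of_fibreMeasure_eq` — if both measures are carried by `h⁻¹(F)` and
  `μ_b(S₁) = κ μ_b(S₂)` for every `b ∈ F`, then `∫ Ψ dν_{S₁} = κ ∫ Ψ dν_{S₂}` for every `ν`-integrable `Ψ`;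
* `apply_eq_smul_of_fibreMeasure_eq_of_hasCompactSupport` — hence `S₁ Ψ = κ S₂ Ψ` for compactly supported `Ψ ∈ 𝒮_ℝ(X)`;
* `linearMap_eq_smul_of_fibreMeasure_eq` — and `S₁ = κ S₂` on ALL of `𝒮_ℝ(X)` as soon as both functionals are
  continuous along one sequence of compactly supported cut-offs (`AdelicFibreMeasuresCutoff`: for `E_X` this is the
  family-uniform condition (B), for the theta integral dominated convergence).
* ED. 2: `linearMap_eq_smul_of_forall_integral_fibreMeasure_eq` — the same closing step with the fibrewise hypothesis
  weakened to the INTEGRAL-TESTED form `∫ Ψ dμ_b(S₁) = κ ∫ Ψ dμ_b(S₂)` for every `b ∈ F` and every COMPACTLY SUPPORTED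
  `Ψ ∈ 𝒮_ℝ(X)` (no equality of fibre MEASURES needed): this is the form in which Weil's split-place argument
  [Weil1965, n° 51, (39)–(40)] delivers the comparison — tested against Schwartz–Bruhat functions («mesures tempérées»),
  the archimedean factor admitting no indicator test functions.

## References

* A. Weil, *Sur la formule de Siegel dans la théorie des groupes classiques*, Acta Math. 113 (1965): Chap. IV n° 46
  p. 66, n° 50–51 pp. 72–75 (Théorème 5) [Weil1965].
-/

noncomputable section

open MeasureTheory NumberField IsDedekindDomain Filter Topology Set Literature.NumberTheory.Automorphic
  Literature.MeasureTheory.RieszRepresentation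
open scoped Classical NNReal

namespace Literature.NumberTheory.Weil1965

variable (F : Type) [Field F] [NumberField F] (ι : Type) [Fintype ι]
  [MeasurableSpace (AdeleRing (𝓞 F) F)] [BorelSpace (AdeleRing (𝓞 F) F)]
  (S₁ S₂ : piSchwartzBruhatReal F ι →ₗ[ℝ] ℝ)
  (hS₁ : ∀ Ψ : piSchwartzBruhatReal F ι, 0 ≤ (Ψ : (ι → AdeleRing (𝓞 F) F) → ℝ) → 0 ≤ S₁ Ψ)
  (hS₂ : ∀ Ψ : piSchwartzBruhatReal F ι, 0 ≤ (Ψ : (ι → AdeleRing (𝓞 F) F) → ℝ) → 0 ≤ S₂ Ψ)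
  (h : (ι → AdeleRing (𝓞 F) F) → AdeleRing (𝓞 F) F) (hh : Continuous h)
  (h0₁ : ∀ (Ψ : piSchwartzBruhatReal F ι) (L : Set (ι → AdeleRing (𝓞 F) F)), IsCompact L →
    (∀ x ∈ L, (QuotientAddGroup.mk (h x) : adeleQuotient F) ≠ 0) →
    tsupport (Ψ : (ι → AdeleRing (𝓞 F) F) → ℝ) ⊆ L → S₁ Ψ = 0)
  (h0₂ : ∀ (Ψ : piSchwartzBruhatReal F ι) (L : Set (ι → AdeleRing (𝓞 F) F)), IsCompact L →
    (∀ x ∈ L, (QuotientAddGroup.mk (h x) : adeleQuotient F) ≠ 0) →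
    tsupport (Ψ : (ι → AdeleRing (𝓞 F) F) → ℝ) ⊆ L → S₂ Ψ = 0)
  (κ : ℝ≥0) (hfib : ∀ b : F, fibreMeasure F ι S₁ hS₁ h b = κ • fibreMeasure F ι S₂ hS₂ h b)

include hh h0₁ h0₂ hfib

/-- **Fibrewise `μ_b(S₁) = κ μ_b(S₂)` ⇒ `ν_{S₁} = κ ν_{S₂}`** (both measures are the sums of their fibre measures).
[cite: Weil1965, Chap. IV n° 51, Théorème 5, p. 75] -/
theorem schwartzBruhatMeasure_eq_smul_of_fibreMeasure_eq :
    schwartzBruhatMeasure F ι S₁ hS₁ = κ • schwartzBruhatMeasure F ι S₂ hS₂ := by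
  haveI : Countable F := NumberField.countable' (K := F)
  rw [← sum_fibreMeasure F ι S₁ hS₁ h hh h0₁, ← sum_fibreMeasure F ι S₂ hS₂ h hh h0₂]
  simp only [hfib]
  ext s hs
  rw [Measure.sum_apply _ hs, Measure.smul_apply, Measure.sum_apply _ hs]
  simp only [Measure.smul_apply, ENNReal.smul_def, smul_eq_mul, ENNReal.tsum_mul_left]

/-- **`∫ Ψ dν_{S₁} = κ ∫ Ψ dν_{S₂}`** for every `Ψ`. [cite: Weil1965, Chap. IV n° 51, Théorème 5, p. 75] -/
theorem integral_schwartzBruhatMeasure_eq_smul_of_fibreMeasure_eq {E : Type*} [NormedAddCommGroup E]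
    [NormedSpace ℝ E] (Ψ : (ι → AdeleRing (𝓞 F) F) → E) :
    ∫ x, Ψ x ∂(schwartzBruhatMeasure F ι S₁ hS₁) = (κ : ℝ) • ∫ x, Ψ x ∂(schwartzBruhatMeasure F ι S₂ hS₂) := by
  rw [schwartzBruhatMeasure_eq_smul_of_fibreMeasure_eq F ι S₁ S₂ hS₁ hS₂ h hh h0₁ h0₂ κ hfib,
    integral_smul_nnreal_measure, NNReal.smul_def]

/-- **`S₁ Ψ = κ S₂ Ψ` for compactly supported `Ψ ∈ 𝒮_ℝ(X)`** (there the functionals ARE their measures).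
[cite: Weil1965, Chap. IV n° 51, Théorème 5, p. 75] -/
theorem apply_eq_smul_of_fibreMeasure_eq_of_hasCompactSupport (Ψ : piSchwartzBruhatReal F ι)
    (hΨ : HasCompactSupport (Ψ : (ι → AdeleRing (𝓞 F) F) → ℝ)) : S₁ Ψ = (κ : ℝ) * S₂ Ψ := by
  rw [← integral_schwartzBruhatMeasure_eq_of_hasCompactSupport F ι S₁ hS₁ Ψ hΨ,
    ← integral_schwartzBruhatMeasure_eq_of_hasCompactSupport F ι S₂ hS₂ Ψ hΨ,
    integral_schwartzBruhatMeasure_eq_smul_of_fibreMeasure_eq F ι S₁ S₂ hS₁ hS₂ h hh h0₁ h0₂ κ hfib, smul_eq_mul]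

/-- **THE CLOSING STEP: `S₁ = κ S₂` on all of `𝒮_ℝ(X)`** from fibrewise proportional measures, provided both
functionals are continuous along one sequence of compactly supported cut-offs `c_n ∈ 𝒮_ℝ(X)`.
[cite: Weil1965, Chap. IV n° 51, Théorème 5, p. 75] -/
theorem linearMap_eq_smul_of_fibreMeasure_eq (c : ℕ → (ι → AdeleRing (𝓞 F) F) → ℝ)
    (hc : ∀ n, c n ∈ piSchwartzBruhatReal F ι) (hcs : ∀ n, HasCompactSupport (c n))
    (h₁ : ∀ Ψ : piSchwartzBruhatReal F ι, Tendsto (fun n => S₁ ⟨(Ψ : (ι → AdeleRing (𝓞 F) F) → ℝ) * c n,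
      mul_mem_piSchwartzBruhatReal Ψ.2 (hc n)⟩) atTop (𝓝 (S₁ Ψ)))
    (h₂ : ∀ Ψ : piSchwartzBruhatReal F ι, Tendsto (fun n => S₂ ⟨(Ψ : (ι → AdeleRing (𝓞 F) F) → ℝ) * c n,
      mul_mem_piSchwartzBruhatReal Ψ.2 (hc n)⟩) atTop (𝓝 (S₂ Ψ))) :
    S₁ = (κ : ℝ) • S₂ :=
  linearMap_eq_of_tendsto_cutoff F ι S₁ ((κ : ℝ) • S₂) c hc hcs h₁
    (fun Ψ => by
      simp only [LinearMap.smul_apply, smul_eq_mul]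
      exact (h₂ Ψ).const_mul _)
    fun Ψ hΨ => by
      rw [LinearMap.smul_apply, smul_eq_mul]
      exact apply_eq_smul_of_fibreMeasure_eq_of_hasCompactSupport F ι S₁ S₂ hS₁ hS₂ h hh h0₁ h0₂ κ hfib Ψ hΨ

/-! ### ED. 2 — the integral-tested form of the closing step -/

omit hfib in
/-- **THE CLOSING STEP, INTEGRAL-TESTED FORM: `S₁ = κ S₂` on all of `𝒮_ℝ(X)`** as soon as, for every `b ∈ F` and every
COMPACTLY SUPPORTED `Ψ ∈ 𝒮_ℝ(X)`, `∫ Ψ dμ_b(S₁) = κ ∫ Ψ dμ_b(S₂)` (`hfib'`; `κ` any real number), both functionals being carried by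
`h⁻¹(F)` (`h0₁`, `h0₂`) and continuous along one sequence of compactly supported cut-offs (`h₁`, `h₂`).  On a compactly
supported `Ψ` both functionals ARE their Radon measures (`integral_schwartzBruhatMeasure_eq_of_hasCompactSupport`; `Ψ` is
integrable since the measures are finite on compacta, `regular_schwartzBruhatMeasure`), the measures are the sums of their fibres
(`integral_schwartzBruhatMeasure_eq_tsum`), and `linearMap_eq_of_tendsto_cutoff` extends the identity to all of `𝒮_ℝ(X)`.
This is the form in which the split-place comparison of [Weil1965, n° 51] is delivered (test functions, not rectangles: the
archimedean factor of `X` carries no indicator Schwartz–Bruhat functions). [cite: Weil1965, Chap. VI n° 52, Théorème 5, pp. 76–77] [cite: Weil1965, Chap. V n° 50, pp. 72–74] -/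
theorem linearMap_eq_smul_of_forall_integral_fibreMeasure_eq (κ' : ℝ)
    (hfib' : ∀ (b : F) (Ψ : piSchwartzBruhatReal F ι), HasCompactSupport (Ψ : (ι → AdeleRing (𝓞 F) F) → ℝ) →
      ∫ x, (Ψ : (ι → AdeleRing (𝓞 F) F) → ℝ) x ∂(fibreMeasure F ι S₁ hS₁ h b) =
        κ' * ∫ x, (Ψ : (ι → AdeleRing (𝓞 F) F) → ℝ) x ∂(fibreMeasure F ι S₂ hS₂ h b))
    (c : ℕ → (ι → AdeleRing (𝓞 F) F) → ℝ) (hc : ∀ n, c n ∈ piSchwartzBruhatReal F ι)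
    (hcs : ∀ n, HasCompactSupport (c n))
    (h₁ : ∀ Ψ : piSchwartzBruhatReal F ι, Tendsto (fun n => S₁ ⟨(Ψ : (ι → AdeleRing (𝓞 F) F) → ℝ) * c n,
      mul_mem_piSchwartzBruhatReal Ψ.2 (hc n)⟩) atTop (𝓝 (S₁ Ψ)))
    (h₂ : ∀ Ψ : piSchwartzBruhatReal F ι, Tendsto (fun n => S₂ ⟨(Ψ : (ι → AdeleRing (𝓞 F) F) → ℝ) * c n,
      mul_mem_piSchwartzBruhatReal Ψ.2 (hc n)⟩) atTop (𝓝 (S₂ Ψ))) :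
    S₁ = κ' • S₂ := by
  haveI := secondCountableTopology_adeleRing (K := F)
  haveI : BorelSpace (ι → AdeleRing (𝓞 F) F) := Pi.borelSpace
  refine linearMap_eq_of_tendsto_cutoff F ι S₁ (κ' • S₂) c hc hcs h₁ (fun Ψ => ?_) (fun Ψ hΨ => ?_)
  · simp only [LinearMap.smul_apply, smul_eq_mul]
    exact (h₂ Ψ).const_mul κ'
  · -- on a compactly supported `Ψ` both functionals are integrals against their measures, which are sums of fibres
    have hint : ∀ (S : piSchwartzBruhatReal F ι →ₗ[ℝ] ℝ)
        (hS : ∀ Ψ : piSchwartzBruhatReal F ι, 0 ≤ (Ψ : (ι → AdeleRing (𝓞 F) F) → ℝ) → 0 ≤ S Ψ),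
        Integrable (Ψ : (ι → AdeleRing (𝓞 F) F) → ℝ) (schwartzBruhatMeasure F ι S hS) := fun S hS => by
      haveI := regular_schwartzBruhatMeasure F ι S hS
      exact (continuous_of_mem_piSchwartzBruhatReal Ψ.2).integrable_of_hasCompactSupport hΨ
    rw [LinearMap.smul_apply, smul_eq_mul, ← integral_schwartzBruhatMeasure_eq_of_hasCompactSupport F ι S₁ hS₁ Ψ hΨ,
      ← integral_schwartzBruhatMeasure_eq_of_hasCompactSupport F ι S₂ hS₂ Ψ hΨ,
      integral_schwartzBruhatMeasure_eq_tsum F ι S₁ hS₁ h hh h0₁ (hint S₁ hS₁),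
      integral_schwartzBruhatMeasure_eq_tsum F ι S₂ hS₂ h hh h0₂ (hint S₂ hS₂), ← tsum_mul_left]
    exact tsum_congr fun b => hfib' b Ψ hΨ

end Literature.NumberTheory.Weil1965
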